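import Mathlib
import Summits.NavierStokesRegularity.NavierStokesRegularity.Theorems.EulerZoomLiouvillePowerGaugeEulerLiouvilleSelfSimilarPastProfileGradient
import HarnessLib

/-!
# PAST-EXACT self-similar members of crux E: the `E`-gauge (dissipation) in profile variables at LARGE SCALES
# (crux `EulerZoomLiouville.PowerGaugeEulerLiouville` = stmt-NavierStokesRegularity-19832, line `birth`, rung C1 — transport brick 2)

Route `EulerZoomLiouville` (NavierStokesRegularity); width seat ns-ezl-w1 under the interim LEAD ns-typeII-p2 g9
(assignment of 2026-08-28T03:17:55Z, brick 2).  Sequel of `…SelfSimilarPastProfileGradient` (brick 1: the weak gradient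
`H` of a member that is exactly self-similar about `(T, x₀)` on the past sub-slab `τ < T₁` is a.e. the self-similar gradient
`(T − τ)^{−1} G((T − τ)^{−γ}(x − x₀))` of a profile gradient `G`).  Here the power gauge `a^{ρ} E(a; 0; H) ≤ c` (all `a > 0`;
`E = cknE`, the scaled dissipation on the parabolic window `Q_a(0,0) = (−a², 0) × B_a`) is read in profile variables AT
LARGE SCALES — the twin, for past-exact / shifted members, of the ball form `∫_{B_L}|∇V|²_F ≤ ((1−ρ)/(2+ρ)) c L^{1−ρ}` of the
lineage's dictionary (`profile_gradient_weight_of_gaugeE` + `EnergySaturation.lintegral_ball_frobenius_le_of_weight`), with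
the same exponent `1 − ρ`:

* `Past.lintegral_ball_frobeniusNormSq_shiftedGradient_ge` — per slice: for `s > 0` and `s^{γ} L + ‖x₀‖ ≤ a`,
  `s^{3γ−2} ∫_{B_L} |G|²_F ≤ ∫_{B_a} |s^{−1} G(s^{−γ}(· − x₀))|²_F` (affine change of variables `x = x₀ + s^{γ} y`);
* `Past.profile_gradient_growth_of_gaugeE_past` — THE BRICK: if `H(τ) = (T − τ)^{−1} • G((T − τ)^{−γ}(· − x₀))` a.e., for
  a.e. `τ < T₁` (`T₁ ≤ 0`, `T₁ ≤ T`, `γ = 1/(2+ρ)`, `0 < ρ < 1` — exactly brick 1's output, so no representative is needed),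
  and `a^{ρ} E(a; 0; H) ≤ c` for all `a > 0`, then for some `C < ∞`: `∫_{B_L} |G|²_F ≤ C L^{1−ρ}` for every `L ≥ 2 − T₁`
  (the window `τ ∈ (T₁ − 2, T₁ − 1)` of `Q_a(0,0)` with `a = (T − T₁ + 2)^{γ} L + ‖x₀‖`, Tonelli, the slice lemma, and
  the time weight `(T − τ)^{3γ−2} ≥ (T − T₁ + 2)^{3γ−2}`);
* `Past.exists_profileGradient_growth_of_past` — bricks 1 + 2 composed at the member level: weak gradient on the slab +
  past-exact self-similarity of `u` + the `E`-gauge ⇒ a profile gradient `G` (weak derivative of `V`, a.e.-strongly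
  measurable, identified with `H` on the past sub-slab) with `∫_{B_L} |G|²_F ≤ C L^{1−ρ}` for `L ≥ 2 − T₁`.

WHAT THIS IS NOT: not NS, not E, not a stub of the skeleton — a transport lemma `--supports` stmt-19832 (the small-scale
/ weighted form `∫ |G|²_F |y|^{ρ−1} < ∞` is NOT available for past-exact members: small parabolic windows at `(0,0)` do
not see the self-similar era). [folklore]
-/

noncomputable section

-- flat `Theorems/<Route><Decl>…` files of one crux share the namespace of the crux (tree convention: `Summit.<S>.<S>.…`)
set_option linter.dupNamespace false

open MeasureTheory Set Filter Topology Metric Function TopologicalSpace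
open scoped ENNReal NNReal

namespace Summit.NavierStokesRegularity.NavierStokesRegularity.Theorems.PowerGaugeEulerLiouville

open Literature.Analysis Literature.Analysis.FunctionSpaces Literature.Analysis.FluidPDE

namespace Past

/-! ### Per slice: the shifted self-similar gradient on a large ball dominates the profile gradient on `B_L` -/

/-- **Ball integrals of `|H|²_F` for a shifted self-similar gradient — the large-scale lower bound.**  For `s > 0`, a
profile gradient `G`, and radii with `s^{γ} L + ‖x₀‖ ≤ a`:
`s^{3γ−2} ∫_{B_L(0)} |G|²_F ≤ ∫_{B_a(0)} |s^{−1} G(s^{−γ}(x − x₀))|²_F dx`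
(pointwise `|c L|²_F = c²|L|²_F`, the affine change of variables `x = x₀ + s^{γ} y`, whose image of `B_L(0)` lies in `B_a(0)`).
The tree's `lintegral_ball_frobeniusNormSq_selfSimilarGradient` is the exact identity at `x₀ = 0`. [folklore] -/
theorem lintegral_ball_frobeniusNormSq_shiftedGradient_ge (γ : ℝ) {s : ℝ} (hs : 0 < s)
    (x₀ : EuclideanSpace ℝ (Fin 3))
    (G : EuclideanSpace ℝ (Fin 3) → EuclideanSpace ℝ (Fin 3) →L[ℝ] EuclideanSpace ℝ (Fin 3))
    {a L : ℝ} (hLa : s ^ γ * L + ‖x₀‖ ≤ a) :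
    ENNReal.ofReal (s ^ (3 * γ - 2)) *
        ∫⁻ y in ball (0 : EuclideanSpace ℝ (Fin 3)) L, ENNReal.ofReal (frobeniusNormSq (G y)) ≤
      ∫⁻ x in ball (0 : EuclideanSpace ℝ (Fin 3)) a,
        ENNReal.ofReal (frobeniusNormSq (s ^ (-1 : ℝ) • G (s ^ (-γ) • (x - x₀)))) := by
  set σ : ℝ := s ^ γ with hσ
  have hσ0 : 0 < σ := Real.rpow_pos_of_pos hs _
  set F : EuclideanSpace ℝ (Fin 3) → ℝ≥0∞ :=
    fun x => ENNReal.ofReal (frobeniusNormSq (G (s ^ (-γ) • (x - x₀)))) with hF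
  -- pointwise scaling of the integrand
  have h1 : ∀ x, ENNReal.ofReal (frobeniusNormSq (s ^ (-1 : ℝ) • G (s ^ (-γ) • (x - x₀)))) =
      ENNReal.ofReal (s ^ (-2 : ℝ)) * F x := by
    intro x
    simp only [hF]
    rw [frobeniusNormSq_smul, ← ENNReal.ofReal_mul (by positivity), ← Real.rpow_natCast,
      ← Real.rpow_mul hs.le]
    norm_num
  -- the affine change of variables `x = x₀ + σ y`
  have hval : ∀ y, F (x₀ + σ • y) = ENNReal.ofReal (frobeniusNormSq (G y)) := by
    intro y
    simp only [hF, add_sub_cancel_left, smul_smul]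
    rw [hσ, ← Real.rpow_add hs, show -γ + γ = 0 by ring, Real.rpow_zero, one_smul]
  have hpre : ball (0 : EuclideanSpace ℝ (Fin 3)) L ⊆
      (fun y : EuclideanSpace ℝ (Fin 3) => x₀ + σ • y) ⁻¹' ball (0 : EuclideanSpace ℝ (Fin 3)) a := by
    intro y hy
    rw [mem_ball_zero_iff] at hy
    rw [mem_preimage, mem_ball_zero_iff]
    calc ‖x₀ + σ • y‖ ≤ ‖x₀‖ + ‖σ • y‖ := norm_add_le _ _
      _ = ‖x₀‖ + σ * ‖y‖ := by rw [norm_smul, Real.norm_of_nonneg hσ0.le]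
      _ < ‖x₀‖ + σ * L := by gcongr
      _ ≤ a := by rw [hσ]; linarith
  have hcov := setLIntegral_preimage_comp_space_affine hσ0 x₀ F (ball (0 : EuclideanSpace ℝ (Fin 3)) a)
  rw [finrank_euclideanSpace_fin] at hcov
  have hmain : ∫⁻ y in ball (0 : EuclideanSpace ℝ (Fin 3)) L, ENNReal.ofReal (frobeniusNormSq (G y)) ≤
      ENNReal.ofReal (σ ^ 3)⁻¹ * ∫⁻ x in ball (0 : EuclideanSpace ℝ (Fin 3)) a, F x := by
    rw [← hcov]
    calc ∫⁻ y in ball (0 : EuclideanSpace ℝ (Fin 3)) L, ENNReal.ofReal (frobeniusNormSq (G y))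
        = ∫⁻ y in ball (0 : EuclideanSpace ℝ (Fin 3)) L, F (x₀ + σ • y) :=
          lintegral_congr fun y => (hval y).symm
      _ ≤ ∫⁻ y in (fun y : EuclideanSpace ℝ (Fin 3) => x₀ + σ • y) ⁻¹' ball (0 : EuclideanSpace ℝ (Fin 3)) a,
            F (x₀ + σ • y) := lintegral_mono_set hpre
  -- the constants: `s^{3γ−2} σ^{−3} = s^{−2}`
  have hσ3 : σ ^ 3 = s ^ (3 * γ) := by
    rw [hσ, ← Real.rpow_natCast, ← Real.rpow_mul hs.le]
    congr 1
    push_cast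
    ring
  have hcoef : ENNReal.ofReal (s ^ (3 * γ - 2)) * ENNReal.ofReal (σ ^ 3)⁻¹ = ENNReal.ofReal (s ^ (-2 : ℝ)) := by
    rw [← ENNReal.ofReal_mul (Real.rpow_nonneg hs.le _), hσ3, ← Real.rpow_neg hs.le, ← Real.rpow_add hs,
      show 3 * γ - 2 + -(3 * γ) = (-2 : ℝ) by ring]
  calc ENNReal.ofReal (s ^ (3 * γ - 2)) *
        ∫⁻ y in ball (0 : EuclideanSpace ℝ (Fin 3)) L, ENNReal.ofReal (frobeniusNormSq (G y))
      ≤ ENNReal.ofReal (s ^ (3 * γ - 2)) *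
          (ENNReal.ofReal (σ ^ 3)⁻¹ * ∫⁻ x in ball (0 : EuclideanSpace ℝ (Fin 3)) a, F x) :=
        mul_le_mul' le_rfl hmain
    _ = ENNReal.ofReal (s ^ (-2 : ℝ)) * ∫⁻ x in ball (0 : EuclideanSpace ℝ (Fin 3)) a, F x := by
        rw [← mul_assoc, hcoef]
    _ = ∫⁻ x in ball (0 : EuclideanSpace ℝ (Fin 3)) a,
          ENNReal.ofReal (frobeniusNormSq (s ^ (-1 : ℝ) • G (s ^ (-γ) • (x - x₀)))) := by
        rw [← lintegral_const_mul' _ _ ENNReal.ofReal_ne_top]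
        exact lintegral_congr fun x => (h1 x).symm

/-! ### The brick: the `E`-gauge of a past-exact member in profile variables, large scales -/

/-- **THE `E`-GAUGE OF A PAST-EXACT MEMBER IN PROFILE VARIABLES (large scales).**  Let `H` be a.e.-strongly measurable on
the slab `(−∞,0) × ℝ³` with `H(τ) = (T − τ)^{−1} • G((T − τ)^{−γ}(· − x₀))` a.e. on `ℝ³` for a.e. `τ < T₁`, where `T₁ ≤ 0`,
`T₁ ≤ T`, `γ = 1/(2+ρ)`, `0 < ρ < 1` (the output of `Past.exists_profileGradient_ae_of_past`), and suppose the power gauge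
`a^{ρ} E(a; 0; H) ≤ c` for all `a > 0`.  Then for some `C < ∞`: `∫_{B_L} |G|²_F ≤ C L^{1−ρ}` for every `L ≥ 2 − T₁`.
Proof: for such `L` put `S = T − T₁ + 2`, `a = S^{γ} L + ‖x₀‖` (so `a² ≥ 2 − T₁`); the window `(T₁ − 2, T₁ − 1) × B_a` lies in
`Q_a(0,0)`, so by Tonelli and the slice lemma `∫_{T₁−2}^{T₁−1} (T−τ)^{3γ−2} dτ · ∫_{B_L}|G|²_F ≤ ∫∫_{Q_a}|H|²_F ≤ a^{1−ρ} c`, and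
`(T − τ)^{3γ−2} ≥ S^{3γ−2}` on the window (`3γ − 2 < 0`); `C = S^{2−3γ} (S^{γ} + ‖x₀‖)^{1−ρ} c`. [folklore] -/
theorem profile_gradient_growth_of_gaugeE_past {ρ : ℝ} (hρ : 0 < ρ) (hρ1 : ρ < 1)
    {T T₁ : ℝ} (hT₁ : T₁ ≤ 0) (hTT₁ : T₁ ≤ T) (x₀ : EuclideanSpace ℝ (Fin 3))
    {H : ℝ → EuclideanSpace ℝ (Fin 3) → EuclideanSpace ℝ (Fin 3) →L[ℝ] EuclideanSpace ℝ (Fin 3)}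
    {G : EuclideanSpace ℝ (Fin 3) → EuclideanSpace ℝ (Fin 3) →L[ℝ] EuclideanSpace ℝ (Fin 3)} {c : ℝ≥0}
    (hHm : AEStronglyMeasurable (uncurry H)
      (volume.restrict (Iio (0 : ℝ) ×ˢ (univ : Set (EuclideanSpace ℝ (Fin 3))))))
    (hH : ∀ᵐ τ ∂((volume : Measure ℝ).restrict (Iio T₁)),
      H τ =ᵐ[volume] fun x => (T - τ) ^ (-1 : ℝ) • G ((T - τ) ^ (-(1 / (2 + ρ))) • (x - x₀)))
    (hE : ∀ a : ℝ, 0 < a →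
      ENNReal.ofReal (a ^ ρ) * cknE a (0 : ℝ × EuclideanSpace ℝ (Fin 3)) H ≤ (c : ℝ≥0∞)) :
    ∃ C : ℝ≥0∞, C ≠ ⊤ ∧ ∀ L : ℝ, 2 - T₁ ≤ L →
      ∫⁻ y in ball (0 : EuclideanSpace ℝ (Fin 3)) L, ENNReal.ofReal (frobeniusNormSq (G y)) ≤
        C * ENNReal.ofReal (L ^ (1 - ρ)) := by
  set γ : ℝ := 1 / (2 + ρ) with hγ
  have h2ρ : 0 < 2 + ρ := by linarith
  have hγ0 : 0 < γ := by rw [hγ]; positivity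
  have hγ23 : 3 * γ - 2 ≤ 0 := by
    have : γ ≤ 1 / 2 := by
      rw [hγ, div_le_div_iff₀ h2ρ two_pos]; linarith
    linarith
  have h1ρ : 0 ≤ 1 - ρ := by linarith
  have hfm : Measurable fun L : EuclideanSpace ℝ (Fin 3) →L[ℝ] EuclideanSpace ℝ (Fin 3) =>
      ENNReal.ofReal (frobeniusNormSq L) :=
    (SereginZajaczkowski2007.continuous_frobeniusNormSq).measurable.ennreal_ofReal
  -- the time scale `S = T − T₁ + 2` of the window `(T₁ − 2, T₁ − 1)` and the constant
  set S : ℝ := T - T₁ + 2 with hS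
  have hS2 : 2 ≤ S := by rw [hS]; linarith
  have hS0 : 0 < S := by linarith
  set σ : ℝ := S ^ γ with hσ
  have hσ0 : 0 < σ := Real.rpow_pos_of_pos hS0 _
  have hσ1 : 1 ≤ σ := Real.one_le_rpow (by linarith) hγ0.le
  set k : ℝ := S ^ (2 - 3 * γ) * (σ + ‖x₀‖) ^ (1 - ρ) with hk
  refine ⟨ENNReal.ofReal k * (c : ℝ≥0∞), ENNReal.mul_ne_top ENNReal.ofReal_ne_top ENNReal.coe_ne_top,
    fun L hL => ?_⟩
  have hL2 : 2 ≤ L := by linarith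
  have hL0 : 0 < L := by linarith
  -- ### the radius `a = σ L + ‖x₀‖`
  set a : ℝ := σ * L + ‖x₀‖ with ha
  have haL : L ≤ a := by
    have : 1 * L ≤ σ * L := mul_le_mul_of_nonneg_right hσ1 hL0.le
    have := norm_nonneg x₀
    rw [ha]; linarith
  have ha0 : 0 < a := by linarith
  have ha2 : 2 - T₁ ≤ a ^ 2 := by nlinarith
  -- ### (1) the gauge: `X = ∫∫_{Q_a} |H|²_F ≤ a^{1−ρ} c`
  set X : ℝ≥0∞ := ∫⁻ q in parabolicCylinder a (0 : ℝ × EuclideanSpace ℝ (Fin 3)),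
    ENNReal.ofReal (frobeniusNormSq (H q.1 q.2)) with hX
  have hXle : X ≤ ENNReal.ofReal (a ^ (1 - ρ)) * (c : ℝ≥0∞) := by
    have h1 := hE a ha0
    unfold cknE at h1
    have hB0 : ENNReal.ofReal (a ^ ρ) ≠ 0 := by
      rw [ENNReal.ofReal_ne_zero_iff]; exact Real.rpow_pos_of_pos ha0 _
    have hA0 : ENNReal.ofReal a ≠ 0 := by rw [ENNReal.ofReal_ne_zero_iff]; exact ha0
    have key : X = ENNReal.ofReal a * (ENNReal.ofReal (a ^ ρ))⁻¹ *
        (ENNReal.ofReal (a ^ ρ) * ((ENNReal.ofReal a)⁻¹ * X)) := by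
      rw [← mul_assoc, mul_assoc (ENNReal.ofReal a), ENNReal.inv_mul_cancel hB0 ENNReal.ofReal_ne_top,
        mul_one, ← mul_assoc, ENNReal.mul_inv_cancel hA0 ENNReal.ofReal_ne_top, one_mul]
    calc X = _ := key
      _ ≤ ENNReal.ofReal a * (ENNReal.ofReal (a ^ ρ))⁻¹ * (c : ℝ≥0∞) := by gcongr
      _ = ENNReal.ofReal (a ^ (1 - ρ)) * (c : ℝ≥0∞) := by
          rw [← ENNReal.ofReal_inv_of_pos (Real.rpow_pos_of_pos ha0 _), ← ENNReal.ofReal_mul ha0.le]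
          congr 2
          rw [Real.rpow_sub ha0, Real.rpow_one, div_eq_mul_inv]
  -- ### (2) the window `(T₁ − 2, T₁ − 1) × B_a` inside `Q_a(0,0)`
  have hWsub : Ioo (T₁ - 2) (T₁ - 1) ×ˢ ball (0 : EuclideanSpace ℝ (Fin 3)) a ⊆
      parabolicCylinder a (0 : ℝ × EuclideanSpace ℝ (Fin 3)) := by
    intro q hq
    rw [mem_prod, mem_Ioo, mem_ball] at hq
    rw [mem_parabolicCylinder, Prod.fst_zero, Prod.snd_zero, zero_sub]
    exact ⟨⟨by linarith [hq.1.1], by linarith [hq.1.2]⟩, hq.2⟩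
  have hY : ∫⁻ q in Ioo (T₁ - 2) (T₁ - 1) ×ˢ ball (0 : EuclideanSpace ℝ (Fin 3)) a,
      ENNReal.ofReal (frobeniusNormSq (H q.1 q.2)) ≤ X :=
    lintegral_mono_set hWsub
  -- ### (3) Tonelli on the window
  have hHmW : AEMeasurable (fun q : ℝ × EuclideanSpace ℝ (Fin 3) =>
      ENNReal.ofReal (frobeniusNormSq (H q.1 q.2)))
      (((volume : Measure ℝ).restrict (Ioo (T₁ - 2) (T₁ - 1))).prod
        ((volume : Measure (EuclideanSpace ℝ (Fin 3))).restrict (ball 0 a))) := by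
    have hsub : Ioo (T₁ - 2) (T₁ - 1) ×ˢ ball (0 : EuclideanSpace ℝ (Fin 3)) a ⊆
        Iio (0 : ℝ) ×ˢ (univ : Set (EuclideanSpace ℝ (Fin 3))) :=
      prod_mono (fun t ht => by have := ht.2; rw [mem_Iio]; linarith) (subset_univ _)
    have := hfm.comp_aemeasurable (hHm.mono_measure (Measure.restrict_mono hsub le_rfl)).aemeasurable
    rwa [Measure.volume_eq_prod, ← Measure.prod_restrict] at this
  have hYeq : ∫⁻ q in Ioo (T₁ - 2) (T₁ - 1) ×ˢ ball (0 : EuclideanSpace ℝ (Fin 3)) a,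
        ENNReal.ofReal (frobeniusNormSq (H q.1 q.2)) =
      ∫⁻ τ in Ioo (T₁ - 2) (T₁ - 1), ∫⁻ x in ball (0 : EuclideanSpace ℝ (Fin 3)) a,
        ENNReal.ofReal (frobeniusNormSq (H τ x)) := by
    rw [Measure.volume_eq_prod, ← Measure.prod_restrict, lintegral_prod _ hHmW]
  -- ### (4) the a.e. lower bound on the slices of the window
  set J : ℝ≥0∞ := ∫⁻ y in ball (0 : EuclideanSpace ℝ (Fin 3)) L, ENNReal.ofReal (frobeniusNormSq (G y)) with hJ
  have hWT : Ioo (T₁ - 2) (T₁ - 1) ⊆ Iio T₁ := fun t ht => by have := ht.2; rw [mem_Iio]; linarith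
  have hlow : ∀ᵐ τ ∂((volume : Measure ℝ).restrict (Ioo (T₁ - 2) (T₁ - 1))),
      ENNReal.ofReal (S ^ (3 * γ - 2)) * J ≤
        ∫⁻ x in ball (0 : EuclideanSpace ℝ (Fin 3)) a, ENNReal.ofReal (frobeniusNormSq (H τ x)) := by
    filter_upwards [ae_restrict_of_ae_restrict_of_subset hWT hH, ae_restrict_mem measurableSet_Ioo]
      with τ hτ hτW
    have hs : 0 < T - τ := by have := hτW.2; linarith
    have hsS : T - τ ≤ S := by have := hτW.1; rw [hS]; linarith
    -- replace `H τ` by the self-similar gradient on the ball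
    have hcongr : ∫⁻ x in ball (0 : EuclideanSpace ℝ (Fin 3)) a, ENNReal.ofReal (frobeniusNormSq (H τ x)) =
        ∫⁻ x in ball (0 : EuclideanSpace ℝ (Fin 3)) a, ENNReal.ofReal (frobeniusNormSq
          ((T - τ) ^ (-1 : ℝ) • G ((T - τ) ^ (-γ) • (x - x₀)))) :=
      lintegral_congr_ae (ae_restrict_of_ae (hτ.mono fun x hx => by simp only [hx]))
    rw [hcongr]
    have hLa : (T - τ) ^ γ * L + ‖x₀‖ ≤ a := by
      have : (T - τ) ^ γ ≤ σ := Real.rpow_le_rpow hs.le hsS hγ0.le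
      rw [ha]; nlinarith
    calc ENNReal.ofReal (S ^ (3 * γ - 2)) * J ≤ ENNReal.ofReal ((T - τ) ^ (3 * γ - 2)) * J :=
          mul_le_mul' (ENNReal.ofReal_le_ofReal (Real.rpow_le_rpow_of_nonpos hs hsS hγ23)) le_rfl
      _ ≤ _ := lintegral_ball_frobeniusNormSq_shiftedGradient_ge γ hs x₀ G hLa
  -- ### (5) integrate the lower bound over the window (length `1`)
  have hvolW : volume (Ioo (T₁ - 2) (T₁ - 1)) = 1 := by
    rw [Real.volume_Ioo, show T₁ - 1 - (T₁ - 2) = (1 : ℝ) by ring, ENNReal.ofReal_one]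
  have hJle : ENNReal.ofReal (S ^ (3 * γ - 2)) * J ≤ X :=
    calc ENNReal.ofReal (S ^ (3 * γ - 2)) * J
        = ∫⁻ _ in Ioo (T₁ - 2) (T₁ - 1), ENNReal.ofReal (S ^ (3 * γ - 2)) * J := by
          rw [setLIntegral_const, hvolW, mul_one]
      _ ≤ ∫⁻ τ in Ioo (T₁ - 2) (T₁ - 1), ∫⁻ x in ball (0 : EuclideanSpace ℝ (Fin 3)) a,
            ENNReal.ofReal (frobeniusNormSq (H τ x)) := lintegral_mono_ae hlow
      _ = _ := hYeq.symm
      _ ≤ X := hY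
  -- ### (6) assemble
  have haL' : a ^ (1 - ρ) ≤ (σ + ‖x₀‖) ^ (1 - ρ) * L ^ (1 - ρ) := by
    rw [← Real.mul_rpow (by positivity) hL0.le]
    refine Real.rpow_le_rpow ha0.le ?_ h1ρ
    have : ‖x₀‖ ≤ ‖x₀‖ * L := le_mul_of_one_le_right (norm_nonneg _) (by linarith)
    rw [ha]; nlinarith
  have hunit : ENNReal.ofReal (S ^ (2 - 3 * γ)) * ENNReal.ofReal (S ^ (3 * γ - 2)) = 1 := by
    rw [← ENNReal.ofReal_mul (Real.rpow_nonneg hS0.le _), ← Real.rpow_add hS0,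
      show (2 - 3 * γ) + (3 * γ - 2) = 0 by ring, Real.rpow_zero, ENNReal.ofReal_one]
  calc J = ENNReal.ofReal (S ^ (2 - 3 * γ)) * (ENNReal.ofReal (S ^ (3 * γ - 2)) * J) := by
        rw [← mul_assoc, hunit, one_mul]
    _ ≤ ENNReal.ofReal (S ^ (2 - 3 * γ)) * X := by gcongr
    _ ≤ ENNReal.ofReal (S ^ (2 - 3 * γ)) * (ENNReal.ofReal (a ^ (1 - ρ)) * (c : ℝ≥0∞)) := by gcongr
    _ ≤ ENNReal.ofReal (S ^ (2 - 3 * γ)) *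
          (ENNReal.ofReal ((σ + ‖x₀‖) ^ (1 - ρ) * L ^ (1 - ρ)) * (c : ℝ≥0∞)) := by gcongr
    _ = ENNReal.ofReal k * (c : ℝ≥0∞) * ENNReal.ofReal (L ^ (1 - ρ)) := by
        rw [hk, ENNReal.ofReal_mul (by positivity), ENNReal.ofReal_mul (by positivity)]
        ring

/-! ### Bricks 1 + 2 at the member level -/

/-- **Profile gradient with large-scale dissipation growth, for a past-exact member.**  Let `H` be a weak spatial gradient
of `u` on the slab `(−∞,0) × ℝ³`, `u(τ, x) = (T − τ)^{γ−1} V((T − τ)^{−γ}(x − x₀))` for `τ < T₁` (`T₁ ≤ 0`, `T₁ ≤ T`,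
`γ = 1/(2+ρ)`, `0 < ρ < 1`), and `a^{ρ} E(a; 0; H) ≤ c` for all `a > 0`.  Then there is a profile gradient `G` — a.e.-strongly
measurable, a weak derivative of `V` on `ℝ³`, with `H(τ) = (T − τ)^{−1} • G((T − τ)^{−γ}(· − x₀))` a.e. for a.e. `τ < T₁` —
and a constant `C < ∞` with `∫_{B_L} |G|²_F ≤ C L^{1−ρ}` for every `L ≥ 2 − T₁`
(`exists_profileGradient_ae_of_past` + `profile_gradient_growth_of_gaugeE_past`). [folklore] -/
theorem exists_profileGradient_growth_of_past {ρ : ℝ} (hρ : 0 < ρ) (hρ1 : ρ < 1)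
    {T T₁ : ℝ} (hT₁ : T₁ ≤ 0) (hTT₁ : T₁ ≤ T) (x₀ : EuclideanSpace ℝ (Fin 3))
    {u : ℝ → EuclideanSpace ℝ (Fin 3) → EuclideanSpace ℝ (Fin 3)}
    {H : ℝ → EuclideanSpace ℝ (Fin 3) → EuclideanSpace ℝ (Fin 3) →L[ℝ] EuclideanSpace ℝ (Fin 3)} {c : ℝ≥0}
    (hH : HasWeakSpatialGradientOn (slab (EuclideanSpace ℝ (Fin 3)) (Iio 0) isOpen_Iio) u H)
    {V : EuclideanSpace ℝ (Fin 3) → EuclideanSpace ℝ (Fin 3)}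
    (hu : ∀ τ : ℝ, τ < T₁ → u τ = fun x => selfSimilarCollapse (1 / (2 + ρ)) T V τ (x - x₀))
    (hE : ∀ a : ℝ, 0 < a →
      ENNReal.ofReal (a ^ ρ) * cknE a (0 : ℝ × EuclideanSpace ℝ (Fin 3)) H ≤ (c : ℝ≥0∞)) :
    ∃ G : EuclideanSpace ℝ (Fin 3) → EuclideanSpace ℝ (Fin 3) →L[ℝ] EuclideanSpace ℝ (Fin 3),
      AEStronglyMeasurable G volume ∧
      HasWeakFDerivOn (⊤ : Opens (EuclideanSpace ℝ (Fin 3))) volume V G ∧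
      (∀ᵐ τ ∂((volume : Measure ℝ).restrict (Iio T₁)),
        H τ =ᵐ[volume] fun x => (T - τ) ^ (-1 : ℝ) • G ((T - τ) ^ (-(1 / (2 + ρ))) • (x - x₀))) ∧
      ∃ C : ℝ≥0∞, C ≠ ⊤ ∧ ∀ L : ℝ, 2 - T₁ ≤ L →
        ∫⁻ y in ball (0 : EuclideanSpace ℝ (Fin 3)) L, ENNReal.ofReal (frobeniusNormSq (G y)) ≤
          C * ENNReal.ofReal (L ^ (1 - ρ)) := by
  obtain ⟨G, hGm, hVG, hae⟩ := exists_profileGradient_ae_of_past hH hT₁ hTT₁ x₀ hu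
  have hHm : AEStronglyMeasurable (uncurry H)
      (volume.restrict (Iio (0 : ℝ) ×ˢ (univ : Set (EuclideanSpace ℝ (Fin 3))))) := by
    have := hH.locallyIntegrableOn_grad.aestronglyMeasurable
    simpa [slab] using this
  exact ⟨G, hGm, hVG, hae, profile_gradient_growth_of_gaugeE_past hρ hρ1 hT₁ hTT₁ x₀ hHm hae hE⟩

end Past

end Summit.NavierStokesRegularity.NavierStokesRegularity.Theorems.PowerGaugeEulerLiouville
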